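import Mathlib

/-!
# The forced energy lemma: a passively dressed slow mode obeys the BARE majorant (kernel #228, lemmaR-A5 §28(e))

Solo-blind programme, session s89.  Interface between the corner-band energy lemma and LEMMA R.
The slow amplitude `u` is dressed by a damped chain mode `y` through a skew bond pair (read-out `B`,
injection `δ`, fast factor `w(t)`) AND driven by an arbitrary forcing `f(t)` (the non-passive remainder
of the column: lift-up/streak loop, the δ-injection's streak sub-paths, inhomogeneities):
  `u' = α u - B w y + f`,   `y' = -λ y + δ w u`,   `λ ≥ -α`, `B ≥ 0`, `δ > 0`.
CLAIM: if `φ ≥ 0` solves the BARE majorant equation `φ' = α φ + g` with `g ≥ |f|` and `φ(t') ≥ |u(t')|`,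
`y(t') = 0`, then `u(t)² ≤ φ(t)²` for all `t ≥ t'` — i.e. `|u(t)| ≤ e^{∫α}|u(t')| + ∫ e^{∫α}|f|`, the
variation-of-constants majorant of the UNDRESSED slow mode, whatever the fast factor.  This is exactly the
slow inequality the κ = 0⁺ certificate feeds, so the corner band inherits it (lemmaR-A5 §28(e)).

Proof: `E = u² + (B/δ)y²` has `E' = 2αu² - (2B/δ)λy² + 2uf ≤ 2αE + 2|u||f|`; compare `E` with the
strict super-solution `(φ + εη)²`, `η = e^{A(t)-A(t')}(1 + t - t')`, by the boundary-crossing lemma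
`image_le_of_deriv_right_lt_deriv_boundary'`, then let `ε → 0`.
-/

namespace Summit.AnomalousDissipation.AnomalousDissipation.Theorems

open Set Filter Topology

/-- Energy of the forced skew pair (no exponential weight): `u² + (B/δ) y²`. -/
noncomputable def forcedEnergy (u y : ℝ → ℝ) (B δ : ℝ) (t : ℝ) : ℝ := u t ^ 2 + B / δ * y t ^ 2

/-- Exact derivative of the energy along the FORCED skew system. -/
theorem forcedEnergy_hasDerivAt (u y α lam w f : ℝ → ℝ) (B δ : ℝ) (hδ : δ ≠ 0) (t : ℝ)
    (hu : HasDerivAt u (α t * u t - B * w t * y t + f t) t)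
    (hy : HasDerivAt y (-lam t * y t + δ * w t * u t) t) :
    HasDerivAt (forcedEnergy u y B δ)
      (2 * α t * u t ^ 2 - 2 * B / δ * lam t * y t ^ 2 + 2 * u t * f t) t := by
  unfold forcedEnergy
  have hu2 : HasDerivAt (fun s => u s ^ 2) (2 * u t * (α t * u t - B * w t * y t + f t)) t := by
    have := hu.mul hu
    have hfun : (fun s => u s ^ 2) = (u * u) := by funext s; simp [sq]
    rw [hfun]; refine this.congr_deriv ?_; ring
  have hy2 : HasDerivAt (fun s => y s ^ 2) (2 * y t * (-lam t * y t + δ * w t * u t)) t := by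
    have := hy.mul hy
    have hfun : (fun s => y s ^ 2) = (y * y) := by funext s; simp [sq]
    rw [hfun]; refine this.congr_deriv ?_; ring
  have hall := hu2.add (hy2.const_mul (B / δ))
  refine hall.congr_deriv ?_
  field_simp
  ring

/-- THE FORCED ENERGY LEMMA (dressed ≤ bare majorant). -/
theorem forced_dressing_majorant (u y α lam w f g φ A : ℝ → ℝ) (B δ : ℝ) (hB : 0 ≤ B) (hδ : 0 < δ)
    (hu : ∀ t, HasDerivAt u (α t * u t - B * w t * y t + f t) t)
    (hy : ∀ t, HasDerivAt y (-lam t * y t + δ * w t * u t) t)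
    (hgap : ∀ t, -α t ≤ lam t) (hfg : ∀ t, |f t| ≤ g t)
    (hφ : ∀ t, HasDerivAt φ (α t * φ t + g t) t) (hφpos : ∀ t, 0 ≤ φ t)
    (hA : ∀ t, HasDerivAt A (α t) t)
    (t' : ℝ) (hy0 : y t' = 0) (hinit : |u t'| ≤ φ t') :
    ∀ t, t' ≤ t → u t ^ 2 ≤ φ t ^ 2 := by
  intro T hT
  -- the energy and its derivative
  set E : ℝ → ℝ := forcedEnergy u y B δ with hEdef
  set E' : ℝ → ℝ := fun t => 2 * α t * u t ^ 2 - 2 * B / δ * lam t * y t ^ 2 + 2 * u t * f t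
    with hE'def
  have hE : ∀ t, HasDerivAt E (E' t) t := fun t =>
    forcedEnergy_hasDerivAt u y α lam w f B δ hδ.ne' t (hu t) (hy t)
  -- the strict super-solution ψ_ε = φ + ε η, η = e^{A t - A t'} (1 + (t - t'))
  set η : ℝ → ℝ := fun t => Real.exp (A t - A t') * (1 + (t - t')) with hηdef
  have hη : ∀ t, HasDerivAt η (α t * η t + Real.exp (A t - A t')) t := by
    intro t
    have h1 : HasDerivAt (fun s => A s - A t') (α t) t := by
      simpa using (hA t).sub_const (A t')
    have h2 : HasDerivAt (fun s => Real.exp (A s - A t')) (Real.exp (A t - A t') * α t) t := h1.exp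
    have h3 : HasDerivAt (fun s => (1 + (s - t'))) (1 : ℝ) t := by
      simpa using ((hasDerivAt_id t).sub_const t').const_add 1
    have h4 := h2.mul h3
    refine h4.congr_deriv ?_
    simp only [hηdef]
    ring
  have hηpos : ∀ t, t' ≤ t → 0 < η t := fun t ht => by
    simp only [hηdef]
    have : 0 < 1 + (t - t') := by linarith
    positivity
  -- comparison for every ε > 0 on [t', T]
  have hcomp : ∀ ε : ℝ, 0 < ε → E T ≤ (φ T + ε * η T) ^ 2 := by
    intro ε hε
    set ψ : ℝ → ℝ := fun t => φ t + ε * η t with hψdef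
    have hψ : ∀ t, HasDerivAt ψ (α t * ψ t + g t + ε * Real.exp (A t - A t')) t := by
      intro t
      have := (hφ t).add ((hη t).const_mul ε)
      refine this.congr_deriv ?_
      simp only [hψdef]
      ring
    have hψpos : ∀ t, t' ≤ t → 0 < ψ t := fun t ht => by
      simp only [hψdef]
      have := hηpos t ht
      have := hφpos t
      positivity
    set Bd : ℝ → ℝ := fun t => ψ t ^ 2 with hBddef
    set Bd' : ℝ → ℝ := fun t => 2 * ψ t * (α t * ψ t + g t + ε * Real.exp (A t - A t')) with hBd'def
    have hBd : ∀ t, HasDerivAt Bd (Bd' t) t := by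
      intro t
      have := (hψ t).mul (hψ t)
      have hfun : Bd = (ψ * ψ) := by funext s; simp [hBddef, sq]
      rw [hfun]
      refine this.congr_deriv ?_
      simp only [hBd'def]
      ring
    have key := image_le_of_deriv_right_lt_deriv_boundary' (f := E) (f' := E') (a := t') (b := T)
      (fun x _ => (hE x).continuousAt.continuousWithinAt)
      (fun x _ => (hE x).hasDerivWithinAt)
      (B := Bd) (B' := Bd') ?_ (fun x _ => (hBd x).continuousAt.continuousWithinAt)
      (fun x _ => (hBd x).hasDerivWithinAt) ?_
    · exact key (right_mem_Icc.mpr hT)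
    · -- initial comparison: E t' = u t'^2 ≤ φ t'^2 ≤ ψ t'^2
      simp only [hEdef, forcedEnergy, hy0, hBddef, hψdef]
      have h1 : u t' ^ 2 ≤ φ t' ^ 2 := by
        have := sq_le_sq' (by linarith [abs_le.mp hinit]) (abs_le.mp hinit).2
        simpa using this
      have h2 : φ t' ≤ φ t' + ε * η t' := by
        have := hηpos t' le_rfl; nlinarith
      have h3 : φ t' ^ 2 ≤ (φ t' + ε * η t') ^ 2 := by
        have := hφpos t'
        exact pow_le_pow_left₀ this h2 2
      simp
      linarith
    · -- strict crossing condition at touching points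
      intro x hx hEx
      have hx' : t' ≤ x := hx.1
      have hψx := hψpos x hx'
      -- |u x| ≤ ψ x from E x = ψ x ^ 2 and E ≥ u²
      have hEx' : u x ^ 2 + B / δ * y x ^ 2 = ψ x ^ 2 := by
        simpa [hEdef, forcedEnergy, hBddef] using hEx
      have hyx : 0 ≤ B / δ * y x ^ 2 := by positivity
      have hux : |u x| ≤ ψ x := by
        have : u x ^ 2 ≤ ψ x ^ 2 := by linarith
        exact abs_le.mpr (abs_le_of_sq_le_sq' this hψx.le)
      -- E' x ≤ 2 α ψ² + 2 ψ g < Bd' x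
      have h1 : 2 * u x * f x ≤ 2 * ψ x * g x := by
        have hu1 : |u x * f x| ≤ ψ x * g x := by
          rw [abs_mul]
          exact mul_le_mul hux (hfg x) (abs_nonneg _) hψx.le
        have := le_abs_self (u x * f x)
        linarith
      have h2 : 2 * α x * u x ^ 2 - 2 * B / δ * lam x * y x ^ 2 ≤ 2 * α x * ψ x ^ 2 := by
        have : 0 ≤ 2 * B / δ * (lam x + α x) * y x ^ 2 := by
          have := hgap x
          have h' : 0 ≤ lam x + α x := by linarith
          positivity
        have e2 : 2 * α x * ψ x ^ 2 - (2 * α x * u x ^ 2 - 2 * B / δ * lam x * y x ^ 2)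
            = 2 * B / δ * (lam x + α x) * y x ^ 2 := by
          rw [← hEx']; ring
        linarith [e2, this]
      have h3 : 0 < 2 * ψ x * (ε * Real.exp (A x - A t')) := by positivity
      show E' x < Bd' x
      simp only [hE'def, hBd'def]
      nlinarith [h1, h2, h3]
  -- let ε → 0
  have hlim : Tendsto (fun ε : ℝ => (φ T + ε * η T) ^ 2) (𝓝[>] 0) (𝓝 ((φ T + 0 * η T) ^ 2)) := by
    have hc : Continuous (fun ε : ℝ => (φ T + ε * η T) ^ 2) := by continuity
    exact (hc.tendsto 0).mono_left nhdsWithin_le_nhds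
  simp only [zero_mul, add_zero] at hlim
  have hET : E T ≤ φ T ^ 2 :=
    ge_of_tendsto hlim (eventually_nhdsWithin_of_forall fun ε hε => hcomp ε hε)
  have : u T ^ 2 ≤ E T := by
    simp only [hEdef, forcedEnergy]
    have : 0 ≤ B / δ * y T ^ 2 := by positivity
    linarith
  linarith

end Summit.AnomalousDissipation.AnomalousDissipation.Theorems
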